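import Literature.MathematicalPhysics.QuantumFieldTheory.PlaqSystemReplicaFormula
import HarnessLib

/-!
# Exponential clustering for a general plaquette system at strong coupling

Support for `UniformTorusClustering` (Osterwalder–Seiler, Ann. Phys. 110 (1978) 440, Thm. 3.5
with Remark (3.9), periodic rendering). For an abstract plaquette system `S : PlaqSystem d G ι`
(`StrongCouplingPolymerSystem`) with regularity constants `M, D`, two bounded measurable
observables `F₁, F₂` supported on DISJOINT bond sets `B₁, B₂`, and a finite label set `V` such
that every polymer `Q ⊆ V` joining `B₁` to `B₂` (`S.Joins`, `PlaqSystemReplica`) has at least `n`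
labels, the truncated expectation `⟨F₁F₂⟩_V − ⟨F₁⟩_V ⟨F₂⟩_V` (complex coupling, `S.expect`) is

* `O(β^n)` at `β = 0` (`isBigO_truncatedExpect`: the replica expansion over joining polymers,
  each term `O(β^{|Q|})`, and `Z_V → 1`);
* bounded by an explicit `K(C₁, C₂, seeds)` on the strong-coupling disc `‖β‖ ≤ β_R`, uniformly in
  `V` (`norm_truncatedExpect_le_const`, from `norm_expect_le`), and holomorphic there;

whence, by the Schwarz lemma with multiplicity (`norm_le_of_isBigO_pow`),
`‖⟨F₁F₂⟩_V − ⟨F₁⟩_V⟨F₂⟩_V‖ ≤ K (‖β‖/r)^n` for `‖β‖ ≤ r < β_R` (`norm_truncatedExpect_le`): exponential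
clustering in the combinatorial distance `n`, with constants independent of `V`. Everything is
proved; no named facts.

## References

* K. Osterwalder, E. Seiler, Ann. Phys. 110 (1978) 440–471, §3, Thm. 3.5 [OsterwalderSeilerAnnPhys1978].
* E. Seiler, LNP 159 (1982), Ch. 3 [SeilerLNP1982].
-/

namespace Literature.MathematicalPhysics.QuantumFieldTheory

open MeasureTheory Measure ProbabilityTheory Finset Filter Asymptotics
open scoped Topology

noncomputable section

namespace PlaqSystem

variable {d : ℕ} {G : Type*} {ι : Type*} {S : PlaqSystem d G ι} [DecidableEq ι]
  [Group G] [TopologicalSpace G] [IsTopologicalGroup G] [CompactSpace G]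
  [MeasurableSpace G] [BorelSpace G] {M : ℝ} {D : ℕ}

omit [DecidableEq ι] [Group G] [TopologicalSpace G] [IsTopologicalGroup G] [CompactSpace G]
  [MeasurableSpace G] [BorelSpace G] in
/-- A product of observables supported on `B₁`, `B₂` is supported on `B₁ ∪ B₂`. [folklore] -/
theorem dependsOn_mul_union {B₁ B₂ : Finset (ZdEdge d)} {F₁ F₂ : ZdGaugeConfig d G → ℂ}
    (hF₁ : DependsOn F₁ (B₁ : Set (ZdEdge d))) (hF₂ : DependsOn F₂ (B₂ : Set (ZdEdge d))) :
    DependsOn (fun U => F₁ U * F₂ U) ((B₁ ∪ B₂ : Finset (ZdEdge d)) : Set (ZdEdge d)) := by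
  intro U U' h
  simp only [Finset.coe_union] at h
  show F₁ U * F₂ U = F₁ U' * F₂ U'
  rw [hF₁ fun e he => h e (Or.inl he), hF₂ fun e he => h e (Or.inr he)]

omit [DecidableEq ι] in
/-- Norm bound for one term of the replica expansion: `‖∫ ΔF₁ ΔF₂ g_Q‖ ≤ 4 C₁ C₂ (8M‖β‖)^{|Q|}` at
strong coupling. [folklore] -/
theorem norm_integral_trunc_dblWeightProd_le (hR : S.Regular M D) {β : ℂ} (hβ : ‖β‖ * M ≤ 1)
    {F₁ F₂ : ZdGaugeConfig d G → ℂ} {C₁ C₂ : ℝ} (h₁b : ∀ U, ‖F₁ U‖ ≤ C₁)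
    (h₂b : ∀ U, ‖F₂ U‖ ≤ C₂) (Q : Finset ι) :
    ‖∫ W, (F₁ W.fst - F₁ W.snd) * (F₂ W.fst - F₂ W.snd) * S.dblWeightProd β Q W ∂dblHaar d G‖ ≤
      4 * C₁ * C₂ * (8 * M * ‖β‖) ^ Q.card := by
  have hC₁ : 0 ≤ C₁ := (norm_nonneg _).trans (h₁b fun _ => 1)
  refine (norm_integral_le_integral_norm _).trans ?_
  refine (integral_mono_of_nonneg (Eventually.of_forall fun _ => norm_nonneg _)
    (integrable_const (4 * C₁ * C₂ * (8 * M * ‖β‖) ^ Q.card))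
    (Eventually.of_forall fun W => ?_)).trans (by simp)
  show ‖(F₁ W.fst - F₁ W.snd) * (F₂ W.fst - F₂ W.snd) * S.dblWeightProd β Q W‖ ≤
    4 * C₁ * C₂ * (8 * M * ‖β‖) ^ Q.card
  rw [norm_mul, norm_mul]
  have e1 : ‖F₁ W.fst - F₁ W.snd‖ ≤ 2 * C₁ :=
    (norm_sub_le _ _).trans (by linarith [h₁b W.fst, h₁b W.snd])
  have e2 : ‖F₂ W.fst - F₂ W.snd‖ ≤ 2 * C₂ :=
    (norm_sub_le _ _).trans (by linarith [h₂b W.fst, h₂b W.snd])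
  calc ‖F₁ W.fst - F₁ W.snd‖ * ‖F₂ W.fst - F₂ W.snd‖ * ‖S.dblWeightProd β Q W‖
      ≤ (2 * C₁) * (2 * C₂) * (8 * M * ‖β‖) ^ Q.card :=
        mul_le_mul (mul_le_mul e1 e2 (norm_nonneg _) (by linarith)) (norm_dblWeightProd_le hR hβ Q W)
          (norm_nonneg _) (by nlinarith [(norm_nonneg _).trans (h₂b W.fst)])
    _ = 4 * C₁ * C₂ * (8 * M * ‖β‖) ^ Q.card := by ring

omit [DecidableEq ι] in
open Classical in
/-- **The truncated numerator is `O(β^n)`** when every polymer joining the (disjoint) supports has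
at least `n` labels: for `8M‖β‖ ≤ 1` (and `‖β‖ M ≤ 1`),
`‖Z_V N_V(F₁F₂) − N_V(F₁)N_V(F₂)‖ ≤ 4 C₁ C₂ 2^{|V|} (8M‖β‖)^n`. [folklore] -/
theorem norm_partZ_mul_numZ_sub_le (hR : S.Regular M D) {B₁ B₂ : Finset (ZdEdge d)}
    {F₁ F₂ : ZdGaugeConfig d G → ℂ} (h₁m : Measurable F₁) (h₂m : Measurable F₂) {C₁ C₂ : ℝ}
    (h₁b : ∀ U, ‖F₁ U‖ ≤ C₁) (h₂b : ∀ U, ‖F₂ U‖ ≤ C₂)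
    (hF₁ : DependsOn F₁ (B₁ : Set (ZdEdge d))) (hF₂ : DependsOn F₂ (B₂ : Set (ZdEdge d)))
    (hB : Disjoint B₁ B₂) (V : Finset ι) {n : ℕ} (hn : ∀ Q, Q ⊆ V → S.Joins Q B₁ B₂ → n ≤ Q.card)
    {β : ℂ} (hβ : ‖β‖ * M ≤ 1) (hβ8 : 8 * M * ‖β‖ ≤ 1) :
    ‖S.partZ V β * S.numZ (fun U => F₁ U * F₂ U) V β - S.numZ F₁ V β * S.numZ F₂ V β‖ ≤
      4 * C₁ * C₂ * 2 ^ V.card * (8 * M * ‖β‖) ^ n := by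
  have hC₁ : 0 ≤ C₁ := (norm_nonneg _).trans (h₁b fun _ => 1)
  have hC₂ : 0 ≤ C₂ := (norm_nonneg _).trans (h₂b fun _ => 1)
  have hε : 0 ≤ 8 * M * ‖β‖ := by have := hR.pos; positivity
  rw [partZ_mul_numZ_sub_eq_sum hR h₁m h₂m h₁b h₂b hF₁ hF₂ hB V β, norm_mul]
  set T := V.powerset.filter (fun Q => S.Joins Q B₁ B₂) with hT
  have hterm : ∀ Q ∈ T, ‖∫ W, (F₁ W.fst - F₁ W.snd) * (F₂ W.fst - F₂ W.snd) *
      S.dblWeightProd β Q W ∂dblHaar d G‖ ≤ 4 * C₁ * C₂ * (8 * M * ‖β‖) ^ n := by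
    intro Q hQ
    rw [hT, Finset.mem_filter, Finset.mem_powerset] at hQ
    refine (norm_integral_trunc_dblWeightProd_le hR hβ h₁b h₂b Q).trans ?_
    exact mul_le_mul_of_nonneg_left (pow_le_pow_of_le_one hε hβ8 (hn Q hQ.1 hQ.2)) (by positivity)
  have hcard : (T.card : ℝ) ≤ 2 ^ V.card := by
    have h1 : T.card ≤ V.powerset.card := Finset.card_filter_le _ _
    rw [Finset.card_powerset] at h1
    exact_mod_cast h1
  calc ‖(1 / 2 : ℂ)‖ * ‖∑ Q ∈ T, ∫ W, (F₁ W.fst - F₁ W.snd) * (F₂ W.fst - F₂ W.snd) *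
          S.dblWeightProd β Q W ∂dblHaar d G‖
      ≤ 1 * ∑ Q ∈ T, ‖∫ W, (F₁ W.fst - F₁ W.snd) * (F₂ W.fst - F₂ W.snd) *
          S.dblWeightProd β Q W ∂dblHaar d G‖ := by
        refine mul_le_mul (by norm_num) (norm_sum_le _ _) (norm_nonneg _) zero_le_one
    _ ≤ 1 * ∑ _Q ∈ T, 4 * C₁ * C₂ * (8 * M * ‖β‖) ^ n := by
        rw [one_mul, one_mul]; exact Finset.sum_le_sum hterm
    _ = T.card * (4 * C₁ * C₂ * (8 * M * ‖β‖) ^ n) := by rw [one_mul, Finset.sum_const, nsmul_eq_mul]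
    _ ≤ 2 ^ V.card * (4 * C₁ * C₂ * (8 * M * ‖β‖) ^ n) :=
        mul_le_mul_of_nonneg_right hcard (by positivity)
    _ = 4 * C₁ * C₂ * 2 ^ V.card * (8 * M * ‖β‖) ^ n := by ring

omit [DecidableEq ι] in
/-- The truncated expectation as a ratio: `⟨F₁F₂⟩ − ⟨F₁⟩⟨F₂⟩ = (Z N₁₂ − N₁N₂)/Z²` (`Z ≠ 0`). [folklore] -/
theorem expect_mul_sub_eq_div {F₁ F₂ : ZdGaugeConfig d G → ℂ} (V : Finset ι) {β : ℂ}
    (hZ : S.partZ V β ≠ 0) :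
    S.expect (fun U => F₁ U * F₂ U) V β - S.expect F₁ V β * S.expect F₂ V β =
      (S.partZ V β * S.numZ (fun U => F₁ U * F₂ U) V β - S.numZ F₁ V β * S.numZ F₂ V β) /
        S.partZ V β ^ 2 := by
  unfold expect
  field_simp

omit [DecidableEq ι] in
/-- `Z_V(0) = 1`. [folklore] -/
theorem partZ_zero (V : Finset ι) : S.partZ V (0 : ℂ) = 1 := by
  rw [partZ_eq]
  simp [weight]

omit [DecidableEq ι] in
/-- **The truncated expectation is `O(β^n)` at `β = 0`** when every polymer joining the disjoint
supports inside `V` has at least `n` labels. [folklore] -/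
theorem isBigO_truncatedExpect (hR : S.Regular M D) {B₁ B₂ : Finset (ZdEdge d)}
    {F₁ F₂ : ZdGaugeConfig d G → ℂ} (h₁m : Measurable F₁) (h₂m : Measurable F₂) {C₁ C₂ : ℝ}
    (h₁b : ∀ U, ‖F₁ U‖ ≤ C₁) (h₂b : ∀ U, ‖F₂ U‖ ≤ C₂)
    (hF₁ : DependsOn F₁ (B₁ : Set (ZdEdge d))) (hF₂ : DependsOn F₂ (B₂ : Set (ZdEdge d)))
    (hB : Disjoint B₁ B₂) (V : Finset ι) {n : ℕ} (hn : ∀ Q, Q ⊆ V → S.Joins Q B₁ B₂ → n ≤ Q.card) :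
    (fun β => S.expect (fun U => F₁ U * F₂ U) V β - S.expect F₁ V β * S.expect F₂ V β)
      =O[𝓝 (0 : ℂ)] fun β => β ^ n := by
  classical
  have hM := hR.pos
  have hC₁ : 0 ≤ C₁ := (norm_nonneg _).trans (h₁b fun _ => 1)
  have hC₂ : 0 ≤ C₂ := (norm_nonneg _).trans (h₂b fun _ => 1)
  -- near `0` the partition function is close to `1`
  have hcont : ContinuousAt (S.partZ V) 0 := (differentiable_partZ hR V 0).continuousAt
  have hZ : ∀ᶠ β in 𝓝 (0 : ℂ), 1 / 2 ≤ ‖S.partZ V β‖ := by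
    have h := (Metric.tendsto_nhds.1 hcont) (1 / 2) (by norm_num)
    filter_upwards [h] with β hβ
    rw [partZ_zero, dist_eq_norm] at hβ
    have h1 : ‖(1 : ℂ)‖ - ‖S.partZ V β‖ ≤ ‖1 - S.partZ V β‖ := norm_sub_norm_le _ _
    rw [norm_one, norm_sub_rev] at h1
    linarith
  -- near `0` the coupling is small
  have hsmall : ∀ᶠ β in 𝓝 (0 : ℂ), 8 * M * ‖β‖ ≤ 1 := by
    have h : Metric.ball (0 : ℂ) (1 / (8 * M)) ∈ 𝓝 (0 : ℂ) := Metric.ball_mem_nhds 0 (by positivity)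
    filter_upwards [h] with β hβ
    rw [Metric.mem_ball, dist_zero_right] at hβ
    have := (lt_div_iff₀ (by positivity : (0 : ℝ) < 8 * M)).1 hβ
    linarith
  refine IsBigO.of_bound (4 * (4 * C₁ * C₂ * 2 ^ V.card * (8 * M) ^ n)) ?_
  filter_upwards [hZ, hsmall] with β hZβ hβ8
  have hβ1 : ‖β‖ * M ≤ 1 := by nlinarith [norm_nonneg β]
  have hZ0 : S.partZ V β ≠ 0 := fun h => by rw [h, norm_zero] at hZβ; linarith
  rw [expect_mul_sub_eq_div V hZ0, norm_div, norm_pow, norm_pow]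
  have hnum := norm_partZ_mul_numZ_sub_le hR h₁m h₂m h₁b h₂b hF₁ hF₂ hB V hn hβ1 hβ8
  have hden : (1 / 2 : ℝ) ^ 2 ≤ ‖S.partZ V β‖ ^ 2 := pow_le_pow_left₀ (by norm_num) hZβ 2
  calc ‖S.partZ V β * S.numZ (fun U => F₁ U * F₂ U) V β - S.numZ F₁ V β * S.numZ F₂ V β‖ /
        ‖S.partZ V β‖ ^ 2
      ≤ (4 * C₁ * C₂ * 2 ^ V.card * (8 * M * ‖β‖) ^ n) / (1 / 2 : ℝ) ^ 2 :=
        div_le_div₀ (by positivity) hnum (by norm_num) hden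
    _ = 4 * (4 * C₁ * C₂ * 2 ^ V.card * (8 * M) ^ n) * ‖β‖ ^ n := by rw [mul_pow]; ring

/-- **Uniform bound on the strong-coupling disc**: `‖⟨F₁F₂⟩_V − ⟨F₁⟩_V⟨F₂⟩_V‖ ≤ K` for `‖β‖ ≤ β_R`,
with `K` depending only on the bounds of `F₁, F₂` and the numbers of labels touching their
supports. [folklore] -/
theorem norm_truncatedExpect_le_const (hR : S.Regular M D) {β : ℂ} (hβ : ‖β‖ ≤ betaR M D)
    {B₁ B₂ : Finset (ZdEdge d)} {F₁ F₂ : ZdGaugeConfig d G → ℂ} (h₁m : Measurable F₁)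
    (h₂m : Measurable F₂) {C₁ C₂ : ℝ} (h₁b : ∀ U, ‖F₁ U‖ ≤ C₁) (h₂b : ∀ U, ‖F₂ U‖ ≤ C₂)
    (hF₁ : DependsOn F₁ (B₁ : Set (ZdEdge d))) (hF₂ : DependsOn F₂ (B₂ : Set (ZdEdge d)))
    (V : Finset ι) :
    ‖S.expect (fun U => F₁ U * F₂ U) V β - S.expect F₁ V β * S.expect F₂ V β‖ ≤
      C₁ * C₂ * (2 * Real.exp (1 / 2)) ^ (S.seedsOf (B₁ ∪ B₂)).card +
        C₁ * (2 * Real.exp (1 / 2)) ^ (S.seedsOf B₁).card *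
          (C₂ * (2 * Real.exp (1 / 2)) ^ (S.seedsOf B₂).card) := by
  have hC₁ : 0 ≤ C₁ := (norm_nonneg _).trans (h₁b fun _ => 1)
  have h12 : ∀ U, ‖F₁ U * F₂ U‖ ≤ C₁ * C₂ := fun U => by
    rw [norm_mul]; exact mul_le_mul (h₁b U) (h₂b U) (norm_nonneg _) hC₁
  refine (norm_sub_le _ _).trans (add_le_add ?_ ?_)
  · exact norm_expect_le hR hβ (h₁m.mul h₂m) h12 (dependsOn_mul_union hF₁ hF₂) V
  · rw [norm_mul]
    exact mul_le_mul (norm_expect_le hR hβ h₁m h₁b hF₁ V) (norm_expect_le hR hβ h₂m h₂b hF₂ V)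
      (norm_nonneg _) (by positivity)

/-- **Exponential clustering for a general plaquette system.** If `F₁, F₂` are bounded measurable
observables supported on disjoint bond sets `B₁, B₂` and every polymer `Q ⊆ V` joining `B₁` to
`B₂` has at least `n` labels, then for `‖β‖ ≤ r < β_R`
`‖⟨F₁F₂⟩_V(β) − ⟨F₁⟩_V(β) ⟨F₂⟩_V(β)‖ ≤ K (‖β‖/r)^n` with the constant `K` of
`norm_truncatedExpect_le_const` — uniformly in the finite label set `V` (Schwarz lemma with
multiplicity applied to the holomorphic, uniformly bounded truncated expectation, which is
`O(β^n)` at the origin). [folklore] -/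
theorem norm_truncatedExpect_le (hR : S.Regular M D) {B₁ B₂ : Finset (ZdEdge d)}
    {F₁ F₂ : ZdGaugeConfig d G → ℂ} (h₁m : Measurable F₁) (h₂m : Measurable F₂) {C₁ C₂ : ℝ}
    (h₁b : ∀ U, ‖F₁ U‖ ≤ C₁) (h₂b : ∀ U, ‖F₂ U‖ ≤ C₂)
    (hF₁ : DependsOn F₁ (B₁ : Set (ZdEdge d))) (hF₂ : DependsOn F₂ (B₂ : Set (ZdEdge d)))
    (hB : Disjoint B₁ B₂) (V : Finset ι) {n : ℕ} (hn : ∀ Q, Q ⊆ V → S.Joins Q B₁ B₂ → n ≤ Q.card)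
    {r : ℝ} (hr : 0 < r) (hrR : r < betaR M D) {β : ℂ} (hβ : ‖β‖ ≤ r) :
    ‖S.expect (fun U => F₁ U * F₂ U) V β - S.expect F₁ V β * S.expect F₂ V β‖ ≤
      (C₁ * C₂ * (2 * Real.exp (1 / 2)) ^ (S.seedsOf (B₁ ∪ B₂)).card +
        C₁ * (2 * Real.exp (1 / 2)) ^ (S.seedsOf B₁).card *
          (C₂ * (2 * Real.exp (1 / 2)) ^ (S.seedsOf B₂).card)) * (‖β‖ / r) ^ n := by
  have hC₁ : 0 ≤ C₁ := (norm_nonneg _).trans (h₁b fun _ => 1)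
  have h12 : ∀ U, ‖F₁ U * F₂ U‖ ≤ C₁ * C₂ := fun U => by
    rw [norm_mul]; exact mul_le_mul (h₁b U) (h₂b U) (norm_nonneg _) hC₁
  have hdiff : DifferentiableOn ℂ
      (fun β => S.expect (fun U => F₁ U * F₂ U) V β - S.expect F₁ V β * S.expect F₂ V β)
      (Metric.ball 0 (betaR M D)) :=
    (differentiableOn_expect hR (h₁m.mul h₂m) h12 V).sub
      ((differentiableOn_expect hR h₁m h₁b V).mul (differentiableOn_expect hR h₂m h₂b V))
  exact norm_le_of_isBigO_pow hdiff
    (fun z hz => norm_truncatedExpect_le_const hR (le_of_lt (mem_ball_zero_iff.1 hz)) h₁m h₂m h₁b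
      h₂b hF₁ hF₂ V)
    (isBigO_truncatedExpect hR h₁m h₂m h₁b h₂b hF₁ hF₂ hB V hn) hr hrR hβ

end PlaqSystem

end

end Literature.MathematicalPhysics.QuantumFieldTheory
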